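import Literature.AnabelianGeometry.SemiGraphs.FiniteEtaleCoveringOfIso

/-!
# Aligned local data: the local and global clauses it yields, and the local clause of composites over any object ([SemiAnbd] §2, Def. 2.2 (i))

Mochizuki, *Semi-graphs of anabelioids*, Publ. RIMS **42** (2006) 221–322, §2, Definition 2.2 (i),
author's manuscript p. 23 [cite: MochizukiSemiAnbd2006, Def. 2.2(i) p.23].

PROOF-ONLY bookkeeping (abc-iut cell, layer L3, row «COMP-LOCAL»; for the F-1478 assembly of
abc-iut-f-161): a morphism `ψ : ℋ → 𝒦` carrying aligned local data `𝔇 : ψ.AlignedLocalData A`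
(`FiniteEtaleCoveringAlignedLift.lean`)

* satisfies the LOCAL description over `A` (`AlignedLocalData.isFiniteEtaleCoveringOf`; the branch
  clause is `le_branchImage` repacked along `edgeOf (ψ b) = ψ (edgeOf b)`);
* satisfies the GLOBAL clause over `A` as soon as `𝔇.lift` is an equivalence through which `ψ^*` factors
  (`AlignedLocalData.isGlobalCoveringOf_of_lift`);
* and then every `χ : 𝒢 → ℋ` locally attached to ANY `B ∈ B(ℋ)` composes to a morphism locally attached
  to `(𝔇.lift⁻¹ B).left` (`Hom.IsFiniteEtaleCoveringOf.comp_of_alignedLocalData'`) — the SAME object as in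
  the global clause of the composite (`Hom.IsGlobalCoveringOf.comp_explicit`, `FiniteEtaleCoveringCompGlobal.lean`).

No definition of a notion, no named fact; nothing here takes a side on [IUTchIII] Cor. 3.12.
-/

namespace Literature.AnabelianGeometry.SemiGraphs

open CategoryTheory CategoryTheory.Limits CategoryTheory.PreGaloisCategory
open Literature.AnabelianGeometry.Anabelioids

universe v₁ u₁ u

-- Mathlib's `Over.pullback` / `Over.post` simp lemmas only fire under the pre-v4.2x defeq transparency
-- behaviour, exactly as in `Mathlib/CategoryTheory/Comma/Over/Pullback.lean` (also: `π₀Obj` coercions).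
set_option backward.isDefEq.respectTransparency false

namespace SemiGraphOfAnabelioids

variable {𝒢 ℋ 𝒦 : SemiGraphOfAnabelioids.{v₁, u₁, u}}

/-- PACKING an existential factorisation at the home edge into the branch clause (transport form).
[cite: MochizukiSemiAnbd2006, Def. 2.2(i) p.23] -/
theorem BObj.exists_transport_of_exists_fac_castT (D : 𝒦.BObj) {e₁ e₂ : 𝒦.graph.Edge} (h : e₁ = e₂)
    (Q : π₀Obj (D.T e₂)) {M : 𝒦.E e₁} (g : M ⟶ D.T e₁)
    (hex : ∃ t' : ((D.castT h Q).1 : 𝒦.E e₁) ⟶ M, t' ≫ g = (D.castT h Q).1.arrow) :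
    ∃ t : (Q.1 : 𝒦.E e₂) ⟶ (𝒦.transportE h).obj M,
      t ≫ (𝒦.transportE h).map g ≫ eqToHom (𝒦.transportE_obj_T D h) = Q.1.arrow := by
  obtain ⟨t', ht'⟩ := hex
  exact D.exists_transport_of_fac_castT h Q g t' ht'

namespace Hom.AlignedLocalData

variable {ψ : Hom ℋ 𝒦} {A : 𝒦.BObj} (𝔇 : ψ.AlignedLocalData A)

/-- The canonical edge label cast to a presentation `e₁ = ψ f` of the image edge is the label at that
presentation. [cite: MochizukiSemiAnbd2006, Def. 2.2(i) p.23] -/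
theorem castT_cE (f : ℋ.graph.Edge) (e₁ : 𝒦.graph.Edge) (h : e₁ = ψ.base.edgeMap f) :
    A.castT h (𝔇.cE f _ rfl) = 𝔇.cE f e₁ h.symm := by
  subst h; rfl

include 𝔇 in
/-- **Aligned local data yield the LOCAL description** of `ψ` over `A` (`Hom.IsFiniteEtaleCoveringOf`):
labels and equivalences are the data; the branch clause is `le_branchImage` (via `inclOfLE`) repacked
along `edgeOf (ψ b) = ψ (edgeOf b)`. [cite: MochizukiSemiAnbd2006, Def. 2.2(i) p.23] -/
theorem isFiniteEtaleCoveringOf (hψ : SemiGraph.IsProper ψ.base) : ψ.IsFiniteEtaleCoveringOf A := by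
  refine ⟨hψ, 𝔇.cV, fun f => 𝔇.cE f _ rfl, 𝔇.cV_bijective, 𝔇.cE_bijective, ?_, ?_, ?_⟩
  · intro w
    exact ⟨𝔇.αV w, 𝔇.αV_isEquivalence w, ⟨𝔇.εV w⟩⟩
  · intro f
    exact ⟨𝔇.αE f _ rfl, 𝔇.αE_isEquivalence f _ rfl, ⟨𝔇.εE f _ rfl⟩⟩
  · intro b₁ w h₁
    apply A.exists_transport_of_exists_fac_castT
    rw [𝔇.castT_cE (ℋ.graph.edgeOf b₁) _ (ψ.base.edgeOf_branchMap b₁)]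
    exact ⟨A.inclOfLE (ψ.base.abuts_branchMap b₁ w h₁) (𝔇.cV w).1 _ (𝔇.le_branchImage b₁ w h₁),
      A.inclOfLE_comp _ _ _ _⟩

/-- **Aligned local data whose lift is an equivalence through which `ψ^*` factors yield the GLOBAL
clause** `B(ℋ) ≃ B(𝒦)_{/A}` (`Hom.IsGlobalCoveringOf`). [cite: MochizukiSemiAnbd2006, Def. 2.2(i) p.23] -/
theorem isGlobalCoveringOf_of_lift [HasBinaryProducts 𝒦.BObj] (h : 𝔇.lift.IsEquivalence)
    (e : ψ.pullbackFunctor ≅ Over.star A ⋙ 𝔇.lift) : ψ.IsGlobalCoveringOf A :=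
  ⟨inferInstance, 𝔇.lift, h, ⟨e⟩⟩

end Hom.AlignedLocalData

/-- **The local clause of a composite, over ANY object of `B(ℋ)`**: if `ψ` carries aligned local data `𝔇`
with `𝔇.lift` an equivalence and `χ : 𝒢 → ℋ` is locally attached to `B ∈ B(ℋ)`, then `χ.comp ψ` is
locally attached to `(𝔇.lift⁻¹ B).left` — the same object of `B(𝒦)` as in
`Hom.IsGlobalCoveringOf.comp_explicit` with `α := 𝔇.lift`. [cite: MochizukiSemiAnbd2006, Def. 2.2(i) p.23] -/
theorem Hom.IsFiniteEtaleCoveringOf.comp_of_alignedLocalData' {χ : Hom 𝒢 ℋ} {ψ : Hom ℋ 𝒦}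
    {A : 𝒦.BObj} (𝔇 : ψ.AlignedLocalData A) [𝔇.lift.IsEquivalence] (hψ : SemiGraph.IsProper ψ.base)
    {B : ℋ.BObj} (hχ : χ.IsFiniteEtaleCoveringOf B) :
    (χ.comp ψ).IsFiniteEtaleCoveringOf (𝔇.lift.inv.obj B).left :=
  Hom.IsFiniteEtaleCoveringOf.comp_of_alignedLocalData 𝔇 (𝔇.lift.inv.obj B) hψ
    (hχ.congr_iso (𝔇.lift.asEquivalence.counitIso.app B).symm)

/-- For print's constructed covering the two descriptions of [SemiAnbd] Def. 2.2 (i) hold over `A` with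
the lift as global witness (repackaging of `FiniteEtaleCoveringAlignedCan.lean`).
[cite: MochizukiSemiAnbd2006, Def. 2.2(i) p.23] -/
theorem BObj.coveringHomCan_isGlobalCoveringOf_via_lift (A : 𝒦.BObj) [HasBinaryProducts 𝒦.BObj] :
    A.coveringHomCan.IsGlobalCoveringOf A :=
  (A.alignedLocalDataCan).isGlobalCoveringOf_of_lift A.alignedLocalDataCan_lift_isEquivalence
    A.coveringHomCan_pullbackFunctor_iso_star_lift

end SemiGraphOfAnabelioids

end Literature.AnabelianGeometry.SemiGraphs
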